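import Summits.QuantumFields.BalabanUV.Beta.GAN24.VHWordsZeroVhSAt
import Summits.QuantumFields.BalabanUV.Beta.GAN24.MultiplierWordsZero
import Summits.QuantumFields.BalabanUV.Beta.GAN24.EEWordSwap
import Summits.QuantumFields.BalabanUV.Beta.GAN24.TwoFaceWordAdditive

/-!
# `BalabanUV.Beta.GAN24.DressedSourceExchangeWords` — binder row G-an2-4 ∕ (CONV-C), W-slot CT-W, conservation law (C)∕(C)sym: **THE TWO EXCHANGE WORDS OF THE ff ZERO MODE OF THE DRESSED
# LEVEL-0 SOURCE ARE THE TWO `S^E ⊗ S^E` NUMBERS** — the assembly of this lineage's blueprint `HOME/b2b-balaban-gan24-formalise-leaf-04/g66/CSYM-LEVEL0-KERNEL-BLUEPRINT.md` §7: the sector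
# split `dM = V^E + V^VH + V^M` (29) in both slots of both words of 21, the eighteen sector words evaluated by 18 ∕ 20 (numbers), 23 (M-words `0`), 24 ∕ 26 ∕ 27 ∕ 28 (VH-words `0`)

NOT IN PRINT; OUR BOOKKEEPING ([folklore] finite bookkeeping BY NAME over this lineage's GAN24 files 18–29; G-an2-4 formalisation swarm, leaf prover `b2b-balaban-gan24-formalise-leaf-04`, gen 66).
HONEST FRAMING (cell contract, verbatim): «discharging `BetaPertH` makes Bałaban's UV stability UNCONDITIONAL — a real constructive-QFT result; it is NOT the continuum limit and NOT the Clay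
problem.»  HONEST DEPENDENCY (verbatim): «continuum YM on T⁴ ⇐ BetaPertH ∧ nine spine estimates (0/9 proved); BetaPertH ⇐ (D1) ∧ (D4) ∧ CAP+tail; G-an2-4 gates asym, D1 and NE2/3/4.»

WHAT ([folklore]; generic `d`, in-block root `ρ = toSite r`, `1 ≤ Lc`, LEVEL 0, period `Lc`, all units `s_f s_m`, colour constants `cE cVH cΛ`, ANY block-covariant multiplier vertex family `M`
at a positive rate, ANY axes `(μ, ν, α, β)`; 0 `def`, 0 cited facts, 0 `def … : Prop`, 0 sorry).  With `X̃♮_0 = unitK s_f s_m (coDressKBmAt ρ Lc (KInvStep Lc 0))`,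
`S♮_0 = unitS s_f s_m (SpureRecAt d Lc ρ cE cVH cΛ 0)`, `FF[K] = Σ'_{(y,w)} 𝟙f(y_α)𝟙f(w_β)·K y w (inl α)(inl β)`, `K₁ = (Lc·s_m s_f·Lc^{−(d+2)})·((s_f s_m)⁻¹ s_f⁻² cE)`:
§1 summability of the lattice-bond families of the sector words (`summable_right_word ∕ summable_left_word`, from 22's `hasSum_slot_word(_left)`); §2 **`sum_box_tsum_direct_word_eq`**:
`Σ_{c∈box Lc} Σ'_{u′} FF[(dM X̃♮_0 Lc S♮_0 M μ c ∘ X̃♮_0) ∘ dM X̃♮_0 Lc S♮_0 M ν u′] = −K₁²·s_f²·E·½·Lc^{d−1}·(Lc^{d+1} − Lc^{d−1})`, `E = [μ=ν][α=β] − [μ=β][α=ν]`;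
**`sum_box_tsum_swap_word_eq`**: `Σ_{c∈box Lc} Σ'_{u′} FF[(dM … ν u′ ∘ X̃♮_0) ∘ dM … μ c] = −K₁²·s_f²·E′·½·Lc^{d−1}·(Lc^{d+1} − Lc^{d−1})`, `E′ = [μ=ν][α=β] − [ν=β][α=μ]`.  With 21
`zmode_dressedSource_inl_inl` the ff zero mode `zmode Lc b̃_0 (μ,ν; inl α, inl β)` is therefore `c·(−(s_f s_m σ₀)²Lc²)·(these two numbers − Σ_{c}Σ'_{u′} FF[W])` — the `K·W·K` word being
the one remaining unevaluated term of piece (I)+(II) of the level-0 (C_1) balance.  Asserts NO value of Bałaban's tables beyond an1's ∕ an3's DEFINED tables; discharges NOTHING of (C)sym ∕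
(Q-D) ∕ (Q-D-rate) ∕ «T2Shape» ∕ «T2Drift» ∕ (hW, hWall); NEVER «G-an2-4 closed» as (CONV-C); NOT D1, NOT `BetaPertH`, NOT continuum, NOT Clay.  2026-08-23; no existing file touched.
-/

noncomputable section

open Finset
open scoped BigOperators
open Literature.MathematicalPhysics.QuantumFieldTheory
open Literature.MathematicalPhysics.QuantumFieldTheory.Balaban1983to89
open Literature.MathematicalPhysics.QuantumFieldTheory.Balaban1983to89.Beta
open ExpKernelCalculus (Site MKer comp shiftK Decays BiLoc VertexFamily biLoc_comp_decays)
open OneStepResolventKernel (Fib LocStencil decays_mono biLoc_mono)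
open BalabanStepJetsSucc (biLoc_comp_right)
open OneStepKernelFamily (KInvStep vertexOfK vertexOfK_translate vertexFamily_vertexOfK decays_KInvStep)
open SecondOrderResponse (dM vertexOfM vertexFamily_vertexOfM)
open StepJetData (wilsonA locStencil_wilsonA locStencil_smul)
open AffineAveraging (box toSite)
open AveragingHessianKernelsRooted (vhSAt)
open Summit.QuantumFields.BalabanUV.Beta.TameKernelCalculus (Loc Spr Tame comp_assoc_tame)
open Summit.QuantumFields.BalabanUV.Beta.AxialDressingRooted (coDressKBmAt decays_coDressKBmAt)
open Summit.QuantumFields.BalabanUV.Beta.HessKerDressedUnits (unitK unitS decays_unitK locStencil_unitS)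
open Summit.QuantumFields.BalabanUV.Beta.SpineRooted (SpureRecAt)
open Summit.QuantumFields.BalabanUV.Beta.GAN24.EEWordReduced (shiftK_dressedStep unitS_wilsonA_translate)
open Summit.QuantumFields.BalabanUV.Beta.GAN24.ExchangeSlotResum (hasSum_slot_word hasSum_slot_word_left face_weight_periodic)
open Summit.QuantumFields.BalabanUV.Beta.GAN24.MultiplierWordsZero (tsum_right_vertexOfM_word_eq_zero tsum_left_vertexOfM_word_eq_zero tsum_vertexOfM_left_cov_word_eq_zero
  tsum_vertexOfM_right_cov_word_eq_zero)
open Summit.QuantumFields.BalabanUV.Beta.GAN24.EEWordSwap (ee_word_value' ee_word_swap_value)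
open Summit.QuantumFields.BalabanUV.Beta.GAN24.VHWordsZeroVhSAt (locStencil_vhS vhS_translate sum_box_vh_wilson_latticeWilson_words_eq_zero sum_box_vh_vh_words_eq_zero
  sum_box_wilson_vh_latticeVH_words_eq_zero)
open Summit.QuantumFields.BalabanUV.Beta.GAN24.VHWordsZeroBorder (unitS_translate_block)
open Summit.QuantumFields.BalabanUV.Beta.GAN24.TwoFaceWordAdditive (twoFace_word_add_left twoFace_word_add_right dM_dressed_level0_split)

namespace Summit.QuantumFields.BalabanUV.Beta.GAN24.DressedSourceExchangeWords

variable {d : ℕ} {Lc : ℕ} [NeZero Lc] {r : Fin (d + 1) → ℕ}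

/-! ## §1 Summability of the lattice-bond families of the sector words -/

section Summable

variable {ρ₁ ρ₂ : Site (d + 1) → ℝ}

/-- [folklore] **THE RIGHT-SLOT FAMILY OF A SECTOR WORD IS SUMMABLE OVER ITS BOND**: `P` localised, `Y` decaying, `Q_{u′}` a vertex family at a positive rate ⟹
`Summable (u′ ↦ FF[(P ∘ Y) ∘ Q_{u′}])` (22 `hasSum_slot_word` at a common rate). -/
theorem summable_right_word {P Y : MKer (d + 1) (Fib d)} (hP : Loc P) (hY : Spr Y) {Q : Fin (d + 1) → Site (d + 1) → MKer (d + 1) (Fib d)} {CQ δQ : ℝ}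
    (hQ : VertexFamily Q Lc CQ δQ) (hδQ : 0 < δQ) (h₁ : ∀ y, |ρ₁ y| ≤ 1) (h₂ : ∀ w, |ρ₂ w| ≤ 1) (ν : Fin (d + 1)) (a b : Fib d) :
    Summable fun u' : Site (d + 1) => ∑' yw : Site (d + 1) × Site (d + 1), ρ₁ yw.1 * ρ₂ yw.2 * comp (comp P Y) (Q ν u') yw.1 yw.2 a b := by
  obtain ⟨p, q, CP, δP, hδP, hPb⟩ := hP
  obtain ⟨CY, δY, hδY, hYd⟩ := hY
  have hCP : 0 ≤ CP := hPb.nonneg (Sum.inl 0)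
  have hCY : 0 ≤ CY := hYd.nonneg (Sum.inl 0)
  have hCQ : 0 ≤ CQ := (hQ ν 0).nonneg (Sum.inl 0)
  set δ₁ : ℝ := min δP (min δY δQ) with hδ₁
  have hδ₁0 : 0 < δ₁ := lt_min hδP (lt_min hδY hδQ)
  have hP1 : BiLoc P p q CP δ₁ := biLoc_mono hPb hCP (min_le_left _ _)
  have hY1 : Decays Y CY δ₁ := decays_mono hYd hCY le_rfl ((min_le_right _ _).trans (min_le_left _ _))
  have hA := biLoc_comp_right hP1 hY1 (half_pos hδ₁0).le (by linarith)
  exact (hasSum_slot_word (N := Lc) (half_pos hδ₁0) hA (fun u => biLoc_mono (hQ ν u) hCQ (by linarith [(min_le_right δP (min δY δQ)).trans (min_le_right δY δQ)])) h₁ h₂ a b).summable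

/-- [folklore] **THE LEFT-SLOT FAMILY OF A SECTOR WORD IS SUMMABLE OVER ITS BOND**: `Summable (u′ ↦ FF[(Q_{u′} ∘ Y) ∘ P])` (re-association, then 22 `hasSum_slot_word_left`). -/
theorem summable_left_word {P Y : MKer (d + 1) (Fib d)} (hP : Loc P) (hY : Spr Y) {Q : Fin (d + 1) → Site (d + 1) → MKer (d + 1) (Fib d)} {CQ δQ : ℝ}
    (hQ : VertexFamily Q Lc CQ δQ) (hδQ : 0 < δQ) (h₁ : ∀ y, |ρ₁ y| ≤ 1) (h₂ : ∀ w, |ρ₂ w| ≤ 1) (ν : Fin (d + 1)) (a b : Fib d) :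
    Summable fun u' : Site (d + 1) => ∑' yw : Site (d + 1) × Site (d + 1), ρ₁ yw.1 * ρ₂ yw.2 * comp (comp (Q ν u') Y) P yw.1 yw.2 a b := by
  have hassoc : ∀ u' : Site (d + 1), comp (comp (Q ν u') Y) P = comp (Q ν u') (comp Y P) :=
    fun u' => (comp_assoc_tame (Loc.tame ⟨_, _, _, _, hδQ, hQ ν u'⟩) hY.tame hP.tame).symm
  simp only [hassoc]
  obtain ⟨p, q, CP, δP, hδP, hPb⟩ := hP
  obtain ⟨CY, δY, hδY, hYd⟩ := hY
  have hCP : 0 ≤ CP := hPb.nonneg (Sum.inl 0)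
  have hCY : 0 ≤ CY := hYd.nonneg (Sum.inl 0)
  have hCQ : 0 ≤ CQ := (hQ ν 0).nonneg (Sum.inl 0)
  set δ₁ : ℝ := min δP (min δY δQ) with hδ₁
  have hδ₁0 : 0 < δ₁ := lt_min hδP (lt_min hδY hδQ)
  have hP1 : BiLoc P p q CP δ₁ := biLoc_mono hPb hCP (min_le_left _ _)
  have hY1 : Decays Y CY δ₁ := decays_mono hYd hCY le_rfl ((min_le_right _ _).trans (min_le_left _ _))
  have hB := biLoc_comp_decays hY1 hP1 (half_pos hδ₁0).le (by linarith)
  exact (hasSum_slot_word_left (N := Lc) (half_pos hδ₁0) hB (fun u => biLoc_mono (hQ ν u) hCQ (by linarith [(min_le_right δP (min δY δQ)).trans (min_le_right δY δQ)])) h₁ h₂ a b).summable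

end Summable

/-! ## §2 The 3 × 3 sector split of a two-face word, summed over the lattice bond -/

section Split

variable {ρ₁ ρ₂ : Site (d + 1) → ℝ} {A₁ A₂ A₃ Y : MKer (d + 1) (Fib d)} {B₁ B₂ B₃ : Fin (d + 1) → Site (d + 1) → MKer (d + 1) (Fib d)} {C₁ δ₁ C₂ δ₂ C₃ δ₃ : ℝ}

/-- [folklore] **THE 3 × 3 SECTOR SPLIT OF THE DIRECT WORD, SUMMED OVER THE LATTICE BOND**: for localised `A_i`, a spread `Y` and vertex families `B_j`,
`Σ'_{u′} FF[((A₁ + (A₂ + A₃)) ∘ Y) ∘ (B₁ u′ + (B₂ u′ + B₃ u′))] = Σ_{i,j} Σ'_{u′} FF[(A_i ∘ Y) ∘ B_j u′]` (29's slot additivity bond by bond; §1's summability term by term). -/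
theorem tsum_direct_word_split (hA₁ : Loc A₁) (hA₂ : Loc A₂) (hA₃ : Loc A₃) (hY : Spr Y) (hB₁ : VertexFamily B₁ Lc C₁ δ₁) (hδ₁ : 0 < δ₁) (hB₂ : VertexFamily B₂ Lc C₂ δ₂) (hδ₂ : 0 < δ₂)
    (hB₃ : VertexFamily B₃ Lc C₃ δ₃) (hδ₃ : 0 < δ₃) (h₁ : ∀ y, |ρ₁ y| ≤ 1) (h₂ : ∀ w, |ρ₂ w| ≤ 1) (ν : Fin (d + 1)) (a b : Fib d) :
    ∑' u' : Site (d + 1), ∑' yw : Site (d + 1) × Site (d + 1), ρ₁ yw.1 * ρ₂ yw.2 * comp (comp (A₁ + (A₂ + A₃)) Y) (B₁ ν u' + (B₂ ν u' + B₃ ν u')) yw.1 yw.2 a b =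
      ((∑' u' : Site (d + 1), ∑' yw : Site (d + 1) × Site (d + 1), ρ₁ yw.1 * ρ₂ yw.2 * comp (comp A₁ Y) (B₁ ν u') yw.1 yw.2 a b) +
        ((∑' u' : Site (d + 1), ∑' yw : Site (d + 1) × Site (d + 1), ρ₁ yw.1 * ρ₂ yw.2 * comp (comp A₁ Y) (B₂ ν u') yw.1 yw.2 a b) +
          ∑' u' : Site (d + 1), ∑' yw : Site (d + 1) × Site (d + 1), ρ₁ yw.1 * ρ₂ yw.2 * comp (comp A₁ Y) (B₃ ν u') yw.1 yw.2 a b)) +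
      (((∑' u' : Site (d + 1), ∑' yw : Site (d + 1) × Site (d + 1), ρ₁ yw.1 * ρ₂ yw.2 * comp (comp A₂ Y) (B₁ ν u') yw.1 yw.2 a b) +
        ((∑' u' : Site (d + 1), ∑' yw : Site (d + 1) × Site (d + 1), ρ₁ yw.1 * ρ₂ yw.2 * comp (comp A₂ Y) (B₂ ν u') yw.1 yw.2 a b) +
          ∑' u' : Site (d + 1), ∑' yw : Site (d + 1) × Site (d + 1), ρ₁ yw.1 * ρ₂ yw.2 * comp (comp A₂ Y) (B₃ ν u') yw.1 yw.2 a b)) +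
      ((∑' u' : Site (d + 1), ∑' yw : Site (d + 1) × Site (d + 1), ρ₁ yw.1 * ρ₂ yw.2 * comp (comp A₃ Y) (B₁ ν u') yw.1 yw.2 a b) +
        ((∑' u' : Site (d + 1), ∑' yw : Site (d + 1) × Site (d + 1), ρ₁ yw.1 * ρ₂ yw.2 * comp (comp A₃ Y) (B₂ ν u') yw.1 yw.2 a b) +
          ∑' u' : Site (d + 1), ∑' yw : Site (d + 1) × Site (d + 1), ρ₁ yw.1 * ρ₂ yw.2 * comp (comp A₃ Y) (B₃ ν u') yw.1 yw.2 a b))) := by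
  have hL : ∀ u' : Site (d + 1), Loc (B₁ ν u') := fun u' => ⟨_, _, _, _, hδ₁, hB₁ ν u'⟩
  have hL₂ : ∀ u' : Site (d + 1), Loc (B₂ ν u') := fun u' => ⟨_, _, _, _, hδ₂, hB₂ ν u'⟩
  have hL₃ : ∀ u' : Site (d + 1), Loc (B₃ ν u') := fun u' => ⟨_, _, _, _, hδ₃, hB₃ ν u'⟩
  -- bond by bond: the right slot, then the left slot
  have e : ∀ u' : Site (d + 1), (∑' yw : Site (d + 1) × Site (d + 1), ρ₁ yw.1 * ρ₂ yw.2 * comp (comp (A₁ + (A₂ + A₃)) Y) (B₁ ν u' + (B₂ ν u' + B₃ ν u')) yw.1 yw.2 a b) =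
      ((∑' yw : Site (d + 1) × Site (d + 1), ρ₁ yw.1 * ρ₂ yw.2 * comp (comp A₁ Y) (B₁ ν u') yw.1 yw.2 a b) +
        ((∑' yw : Site (d + 1) × Site (d + 1), ρ₁ yw.1 * ρ₂ yw.2 * comp (comp A₁ Y) (B₂ ν u') yw.1 yw.2 a b) +
          ∑' yw : Site (d + 1) × Site (d + 1), ρ₁ yw.1 * ρ₂ yw.2 * comp (comp A₁ Y) (B₃ ν u') yw.1 yw.2 a b)) +
      (((∑' yw : Site (d + 1) × Site (d + 1), ρ₁ yw.1 * ρ₂ yw.2 * comp (comp A₂ Y) (B₁ ν u') yw.1 yw.2 a b) +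
        ((∑' yw : Site (d + 1) × Site (d + 1), ρ₁ yw.1 * ρ₂ yw.2 * comp (comp A₂ Y) (B₂ ν u') yw.1 yw.2 a b) +
          ∑' yw : Site (d + 1) × Site (d + 1), ρ₁ yw.1 * ρ₂ yw.2 * comp (comp A₂ Y) (B₃ ν u') yw.1 yw.2 a b)) +
      ((∑' yw : Site (d + 1) × Site (d + 1), ρ₁ yw.1 * ρ₂ yw.2 * comp (comp A₃ Y) (B₁ ν u') yw.1 yw.2 a b) +
        ((∑' yw : Site (d + 1) × Site (d + 1), ρ₁ yw.1 * ρ₂ yw.2 * comp (comp A₃ Y) (B₂ ν u') yw.1 yw.2 a b) +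
          ∑' yw : Site (d + 1) × Site (d + 1), ρ₁ yw.1 * ρ₂ yw.2 * comp (comp A₃ Y) (B₃ ν u') yw.1 yw.2 a b))) := by
    intro u'
    have hR : ∀ {A : MKer (d + 1) (Fib d)}, Loc A → (∑' yw : Site (d + 1) × Site (d + 1), ρ₁ yw.1 * ρ₂ yw.2 * comp (comp A Y) (B₁ ν u' + (B₂ ν u' + B₃ ν u')) yw.1 yw.2 a b) =
        (∑' yw : Site (d + 1) × Site (d + 1), ρ₁ yw.1 * ρ₂ yw.2 * comp (comp A Y) (B₁ ν u') yw.1 yw.2 a b) +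
          ((∑' yw : Site (d + 1) × Site (d + 1), ρ₁ yw.1 * ρ₂ yw.2 * comp (comp A Y) (B₂ ν u') yw.1 yw.2 a b) +
            ∑' yw : Site (d + 1) × Site (d + 1), ρ₁ yw.1 * ρ₂ yw.2 * comp (comp A Y) (B₃ ν u') yw.1 yw.2 a b) := by
      intro A hA
      rw [twoFace_word_add_right hA hY (hL u') ((hL₂ u').add (hL₃ u')) h₁ h₂ a b, twoFace_word_add_right hA hY (hL₂ u') (hL₃ u') h₁ h₂ a b]
    rw [twoFace_word_add_left hA₁ (hA₂.add hA₃) hY ((hL u').add ((hL₂ u').add (hL₃ u'))) h₁ h₂ a b,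
      twoFace_word_add_left hA₂ hA₃ hY ((hL u').add ((hL₂ u').add (hL₃ u'))) h₁ h₂ a b, hR hA₁, hR hA₂, hR hA₃]
  rw [tsum_congr e]
  -- term by term summability, then the lattice sum splits
  have s := fun {A : MKer (d + 1) (Fib d)} (hA : Loc A) {B : Fin (d + 1) → Site (d + 1) → MKer (d + 1) (Fib d)} {C δ : ℝ} (hB : VertexFamily B Lc C δ) (hδ : 0 < δ) =>
    summable_right_word (ρ₁ := ρ₁) (ρ₂ := ρ₂) hA hY hB hδ h₁ h₂ ν a b
  have s11 := s hA₁ hB₁ hδ₁; have s12 := s hA₁ hB₂ hδ₂; have s13 := s hA₁ hB₃ hδ₃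
  have s21 := s hA₂ hB₁ hδ₁; have s22 := s hA₂ hB₂ hδ₂; have s23 := s hA₂ hB₃ hδ₃
  have s31 := s hA₃ hB₁ hδ₁; have s32 := s hA₃ hB₂ hδ₂; have s33 := s hA₃ hB₃ hδ₃
  rw [(s11.add (s12.add s13)).tsum_add ((s21.add (s22.add s23)).add (s31.add (s32.add s33))),
    (s21.add (s22.add s23)).tsum_add (s31.add (s32.add s33)), s11.tsum_add (s12.add s13), s12.tsum_add s13,
    s21.tsum_add (s22.add s23), s22.tsum_add s23, s31.tsum_add (s32.add s33), s32.tsum_add s33]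

/-- [folklore] **THE 3 × 3 SECTOR SPLIT OF THE SWAP WORD, SUMMED OVER THE LATTICE BOND**: `Σ'_{u′} FF[((B₁ u′ + (B₂ u′ + B₃ u′)) ∘ Y) ∘ (A₁ + (A₂ + A₃))] = Σ_{i,j} Σ'_{u′} FF[(B_j u′ ∘ Y) ∘ A_i]`. -/
theorem tsum_swap_word_split (hA₁ : Loc A₁) (hA₂ : Loc A₂) (hA₃ : Loc A₃) (hY : Spr Y) (hB₁ : VertexFamily B₁ Lc C₁ δ₁) (hδ₁ : 0 < δ₁) (hB₂ : VertexFamily B₂ Lc C₂ δ₂) (hδ₂ : 0 < δ₂)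
    (hB₃ : VertexFamily B₃ Lc C₃ δ₃) (hδ₃ : 0 < δ₃) (h₁ : ∀ y, |ρ₁ y| ≤ 1) (h₂ : ∀ w, |ρ₂ w| ≤ 1) (ν : Fin (d + 1)) (a b : Fib d) :
    ∑' u' : Site (d + 1), ∑' yw : Site (d + 1) × Site (d + 1), ρ₁ yw.1 * ρ₂ yw.2 * comp (comp (B₁ ν u' + (B₂ ν u' + B₃ ν u')) Y) (A₁ + (A₂ + A₃)) yw.1 yw.2 a b =
      ((∑' u' : Site (d + 1), ∑' yw : Site (d + 1) × Site (d + 1), ρ₁ yw.1 * ρ₂ yw.2 * comp (comp (B₁ ν u') Y) A₁ yw.1 yw.2 a b) +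
        ((∑' u' : Site (d + 1), ∑' yw : Site (d + 1) × Site (d + 1), ρ₁ yw.1 * ρ₂ yw.2 * comp (comp (B₁ ν u') Y) A₂ yw.1 yw.2 a b) +
          ∑' u' : Site (d + 1), ∑' yw : Site (d + 1) × Site (d + 1), ρ₁ yw.1 * ρ₂ yw.2 * comp (comp (B₁ ν u') Y) A₃ yw.1 yw.2 a b)) +
      (((∑' u' : Site (d + 1), ∑' yw : Site (d + 1) × Site (d + 1), ρ₁ yw.1 * ρ₂ yw.2 * comp (comp (B₂ ν u') Y) A₁ yw.1 yw.2 a b) +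
        ((∑' u' : Site (d + 1), ∑' yw : Site (d + 1) × Site (d + 1), ρ₁ yw.1 * ρ₂ yw.2 * comp (comp (B₂ ν u') Y) A₂ yw.1 yw.2 a b) +
          ∑' u' : Site (d + 1), ∑' yw : Site (d + 1) × Site (d + 1), ρ₁ yw.1 * ρ₂ yw.2 * comp (comp (B₂ ν u') Y) A₃ yw.1 yw.2 a b)) +
      ((∑' u' : Site (d + 1), ∑' yw : Site (d + 1) × Site (d + 1), ρ₁ yw.1 * ρ₂ yw.2 * comp (comp (B₃ ν u') Y) A₁ yw.1 yw.2 a b) +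
        ((∑' u' : Site (d + 1), ∑' yw : Site (d + 1) × Site (d + 1), ρ₁ yw.1 * ρ₂ yw.2 * comp (comp (B₃ ν u') Y) A₂ yw.1 yw.2 a b) +
          ∑' u' : Site (d + 1), ∑' yw : Site (d + 1) × Site (d + 1), ρ₁ yw.1 * ρ₂ yw.2 * comp (comp (B₃ ν u') Y) A₃ yw.1 yw.2 a b))) := by
  have hL : ∀ u' : Site (d + 1), Loc (B₁ ν u') := fun u' => ⟨_, _, _, _, hδ₁, hB₁ ν u'⟩
  have hL₂ : ∀ u' : Site (d + 1), Loc (B₂ ν u') := fun u' => ⟨_, _, _, _, hδ₂, hB₂ ν u'⟩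
  have hL₃ : ∀ u' : Site (d + 1), Loc (B₃ ν u') := fun u' => ⟨_, _, _, _, hδ₃, hB₃ ν u'⟩
  have e : ∀ u' : Site (d + 1), (∑' yw : Site (d + 1) × Site (d + 1), ρ₁ yw.1 * ρ₂ yw.2 * comp (comp (B₁ ν u' + (B₂ ν u' + B₃ ν u')) Y) (A₁ + (A₂ + A₃)) yw.1 yw.2 a b) =
      ((∑' yw : Site (d + 1) × Site (d + 1), ρ₁ yw.1 * ρ₂ yw.2 * comp (comp (B₁ ν u') Y) A₁ yw.1 yw.2 a b) +
        ((∑' yw : Site (d + 1) × Site (d + 1), ρ₁ yw.1 * ρ₂ yw.2 * comp (comp (B₁ ν u') Y) A₂ yw.1 yw.2 a b) +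
          ∑' yw : Site (d + 1) × Site (d + 1), ρ₁ yw.1 * ρ₂ yw.2 * comp (comp (B₁ ν u') Y) A₃ yw.1 yw.2 a b)) +
      (((∑' yw : Site (d + 1) × Site (d + 1), ρ₁ yw.1 * ρ₂ yw.2 * comp (comp (B₂ ν u') Y) A₁ yw.1 yw.2 a b) +
        ((∑' yw : Site (d + 1) × Site (d + 1), ρ₁ yw.1 * ρ₂ yw.2 * comp (comp (B₂ ν u') Y) A₂ yw.1 yw.2 a b) +
          ∑' yw : Site (d + 1) × Site (d + 1), ρ₁ yw.1 * ρ₂ yw.2 * comp (comp (B₂ ν u') Y) A₃ yw.1 yw.2 a b)) +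
      ((∑' yw : Site (d + 1) × Site (d + 1), ρ₁ yw.1 * ρ₂ yw.2 * comp (comp (B₃ ν u') Y) A₁ yw.1 yw.2 a b) +
        ((∑' yw : Site (d + 1) × Site (d + 1), ρ₁ yw.1 * ρ₂ yw.2 * comp (comp (B₃ ν u') Y) A₂ yw.1 yw.2 a b) +
          ∑' yw : Site (d + 1) × Site (d + 1), ρ₁ yw.1 * ρ₂ yw.2 * comp (comp (B₃ ν u') Y) A₃ yw.1 yw.2 a b))) := by
    intro u'
    have hR : ∀ {B : MKer (d + 1) (Fib d)}, Loc B → (∑' yw : Site (d + 1) × Site (d + 1), ρ₁ yw.1 * ρ₂ yw.2 * comp (comp B Y) (A₁ + (A₂ + A₃)) yw.1 yw.2 a b) =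
        (∑' yw : Site (d + 1) × Site (d + 1), ρ₁ yw.1 * ρ₂ yw.2 * comp (comp B Y) A₁ yw.1 yw.2 a b) +
          ((∑' yw : Site (d + 1) × Site (d + 1), ρ₁ yw.1 * ρ₂ yw.2 * comp (comp B Y) A₂ yw.1 yw.2 a b) +
            ∑' yw : Site (d + 1) × Site (d + 1), ρ₁ yw.1 * ρ₂ yw.2 * comp (comp B Y) A₃ yw.1 yw.2 a b) := by
      intro B hB
      rw [twoFace_word_add_right hB hY hA₁ (hA₂.add hA₃) h₁ h₂ a b, twoFace_word_add_right hB hY hA₂ hA₃ h₁ h₂ a b]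
    rw [twoFace_word_add_left (hL u') ((hL₂ u').add (hL₃ u')) hY (hA₁.add (hA₂.add hA₃)) h₁ h₂ a b,
      twoFace_word_add_left (hL₂ u') (hL₃ u') hY (hA₁.add (hA₂.add hA₃)) h₁ h₂ a b, hR (hL u'), hR (hL₂ u'), hR (hL₃ u')]
  rw [tsum_congr e]
  have s := fun {A : MKer (d + 1) (Fib d)} (hA : Loc A) {B : Fin (d + 1) → Site (d + 1) → MKer (d + 1) (Fib d)} {C δ : ℝ} (hB : VertexFamily B Lc C δ) (hδ : 0 < δ) =>
    summable_left_word (ρ₁ := ρ₁) (ρ₂ := ρ₂) hA hY hB hδ h₁ h₂ ν a b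
  have s11 := s hA₁ hB₁ hδ₁; have s12 := s hA₂ hB₁ hδ₁; have s13 := s hA₃ hB₁ hδ₁
  have s21 := s hA₁ hB₂ hδ₂; have s22 := s hA₂ hB₂ hδ₂; have s23 := s hA₃ hB₂ hδ₂
  have s31 := s hA₁ hB₃ hδ₃; have s32 := s hA₂ hB₃ hδ₃; have s33 := s hA₃ hB₃ hδ₃
  rw [(s11.add (s12.add s13)).tsum_add ((s21.add (s22.add s23)).add (s31.add (s32.add s33))),
    (s21.add (s22.add s23)).tsum_add (s31.add (s32.add s33)), s11.tsum_add (s12.add s13), s12.tsum_add s13,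
    s21.tsum_add (s22.add s23), s22.tsum_add s23, s31.tsum_add (s32.add s33), s32.tsum_add s33]

end Split

/-! ## §3 The two exchange words of the dressed level-0 source's ff zero mode are the two `S^E ⊗ S^E` numbers -/

section Assembly

variable {M : Fin (d + 1) → Site (d + 1) → MKer (d + 1) (Fib d)} {CM δM : ℝ} {μ ν α β : Fin (d + 1)}

/-- [folklore] **DATA OF THE THREE SECTOR FAMILIES AT LEVEL 0** (one rate): the dressed kernel is spread; the Wilson, border and multiplier half-vertex families are vertex families. -/
theorem exists_sector_data (hLc : 1 ≤ Lc) (hr : r ∈ box (d + 1) Lc) (sf sm cE cVH : ℝ) (hM : VertexFamily M Lc CM δM) (hδM : 0 < δM) :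
    ∃ δ CX Cv Cw Cm : ℝ, 0 < δ ∧ Decays (unitK sf sm (coDressKBmAt (toSite r) Lc (KInvStep (d := d) Lc 0))) CX δ ∧
      VertexFamily (vertexOfK (unitK sf sm (coDressKBmAt (toSite r) Lc (KInvStep (d := d) Lc 0))) Lc (unitS sf sm (fun κ v => cE • wilsonA d κ v))) Lc Cv δ ∧
      VertexFamily (vertexOfK (unitK sf sm (coDressKBmAt (toSite r) Lc (KInvStep (d := d) Lc 0))) Lc (unitS sf sm (fun κ v => cVH • vhSAt (toSite r) d Lc rfl κ v))) Lc Cw δ ∧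
      VertexFamily (vertexOfM (unitK sf sm (coDressKBmAt (toSite r) Lc (KInvStep (d := d) Lc 0))) Lc M) Lc Cm δ := by
  obtain ⟨δK, CK, hδK, hCK, hXd⟩ := decays_coDressKBmAt hLc hr (decays_KInvStep (d := d) (Lc := Lc) 0)
  have hXu := decays_unitK (sf := sf) (sm := sm) hXd
  have hCX : 0 ≤ max |sf| |sm| * CK * max |sf| |sm| := by positivity
  have hCM : 0 ≤ CM := (hM 0 0).nonneg (Sum.inl 0)
  set δ₁ : ℝ := min δK δM with hδ₁
  have hδ₁0 : 0 < δ₁ := lt_min hδK hδM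
  have hX1 : Decays (unitK sf sm (coDressKBmAt (toSite r) Lc (KInvStep (d := d) Lc 0))) (max |sf| |sm| * CK * max |sf| |sm|) δ₁ := decays_mono hXu hCX le_rfl (min_le_left _ _)
  have hM1 : VertexFamily M Lc CM δ₁ := fun ρ' w => biLoc_mono (hM ρ' w) hCM (min_le_right _ _)
  have hVE := vertexFamily_vertexOfK (N := Lc) hX1 hCX (locStencil_unitS (sf := sf) (sm := sm) (locStencil_smul cE (locStencil_wilsonA (d := d) hδ₁0.le))) hδ₁0 le_rfl
  have hVW := vertexFamily_vertexOfK (N := Lc) hX1 hCX (locStencil_unitS (sf := sf) (sm := sm) (locStencil_vhS hLc hr cVH hδ₁0.le)) hδ₁0 le_rfl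
  have hVM := vertexFamily_vertexOfM hX1 hCX hM1 hδ₁0 le_rfl
  exact ⟨δ₁ / 2, _, _, _, _, half_pos hδ₁0, decays_mono hX1 hCX le_rfl (by linarith), hVE, hVW, hVM⟩

/-- [folklore] **THE DIRECT EXCHANGE WORD OF THE DRESSED LEVEL-0 SOURCE'S ff ZERO MODE IS THE `S^E ⊗ S^E` NUMBER** (in-block root, `1 ≤ Lc`, period `Lc`, all units, colour constants
`cE cVH cΛ`, ANY block-covariant multiplier vertex family `M` at a positive rate, any axes):
`Σ_{c∈box Lc} Σ'_{u′} FF[(dM X̃♮_0 Lc S♮_0 M μ c ∘ X̃♮_0) ∘ dM X̃♮_0 Lc S♮_0 M ν u′] = −K₁²·s_f²·E·½·Lc^{d−1}·(Lc^{d+1} − Lc^{d−1})`, `E = [μ=ν][α=β] − [μ=β][α=ν]` — 29's split, §2, then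
`EEWordSwap.ee_word_value'` and the eight sector zeros (23 ∕ 28). -/
theorem sum_box_tsum_direct_word_eq (hLc : 1 ≤ Lc) (hr : r ∈ box (d + 1) Lc) (sf sm cE cVH cΛ : ℝ) (hM : VertexFamily M Lc CM δM) (hδM : 0 < δM)
    (hMcov : ∀ (ρ' : Fin (d + 1)) (w t : Site (d + 1)), M ρ' (w + t) = shiftK (-((Lc : ℤ) • t)) (M ρ' w)) :
    ∑ c ∈ box (d + 1) Lc, ∑' u' : Site (d + 1), ∑' yw : Site (d + 1) × Site (d + 1), (if yw.1 α % (Lc : ℤ) = (Lc : ℤ) - 1 then (1 : ℝ) else 0) * (if yw.2 β % (Lc : ℤ) = (Lc : ℤ) - 1 then (1 : ℝ) else 0) *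
        comp (comp (dM (unitK sf sm (coDressKBmAt (toSite r) Lc (KInvStep (d := d) Lc 0))) Lc (unitS sf sm (SpureRecAt d Lc (toSite r) cE cVH cΛ 0)) M μ (toSite c))
          (unitK sf sm (coDressKBmAt (toSite r) Lc (KInvStep (d := d) Lc 0))))
          (dM (unitK sf sm (coDressKBmAt (toSite r) Lc (KInvStep (d := d) Lc 0))) Lc (unitS sf sm (SpureRecAt d Lc (toSite r) cE cVH cΛ 0)) M ν u') yw.1 yw.2 (Sum.inl α) (Sum.inl β) =
      -(((((Lc : ℝ) * (sm * sf)) * ((((Lc ^ (0 + 1) : ℕ) : ℝ)) ^ (d + 1 + 1))⁻¹) * ((sf * sm)⁻¹ * (sf⁻¹ * sf⁻¹) * cE))) ^ 2 * (sf * sf) *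
        (((if μ = ν ∧ α = β then (1 : ℝ) else 0) - (if μ = β ∧ α = ν then (1 : ℝ) else 0)) * ((1 / 2 : ℝ) * (Lc : ℝ) ^ (d - 1) * ((Lc : ℝ) ^ (d + 1) - (Lc : ℝ) ^ (d - 1)))) := by
  classical
  obtain ⟨δ, CX, Cv, Cw, Cm, hδ, hXd, hVE, hVW, hVM⟩ := exists_sector_data hLc hr sf sm cE cVH hM hδM
  have hX : Spr (unitK sf sm (coDressKBmAt (toSite r) Lc (KInvStep (d := d) Lc 0))) := ⟨_, _, hδ, hXd⟩
  have hXs : ∀ t : Site (d + 1), shiftK (-((Lc : ℤ) • t)) (unitK sf sm (coDressKBmAt (toSite r) Lc (KInvStep (d := d) Lc 0))) =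
      unitK sf sm (coDressKBmAt (toSite r) Lc (KInvStep (d := d) Lc 0)) := fun t => shiftK_dressedStep (r := r) hLc sf sm 0 t
  have hLE : ∀ (κ : Fin (d + 1)) (u : Site (d + 1)), Loc (vertexOfK (unitK sf sm (coDressKBmAt (toSite r) Lc (KInvStep (d := d) Lc 0))) Lc (unitS sf sm (fun κ v => cE • wilsonA d κ v)) κ u) :=
    fun κ u => ⟨_, _, _, _, hδ, hVE κ u⟩
  have hLW : ∀ (κ : Fin (d + 1)) (u : Site (d + 1)), Loc (vertexOfK (unitK sf sm (coDressKBmAt (toSite r) Lc (KInvStep (d := d) Lc 0))) Lc (unitS sf sm (fun κ v => cVH • vhSAt (toSite r) d Lc rfl κ v)) κ u) :=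
    fun κ u => ⟨_, _, _, _, hδ, hVW κ u⟩
  have hLM : ∀ (κ : Fin (d + 1)) (u : Site (d + 1)), Loc (vertexOfM (unitK sf sm (coDressKBmAt (toSite r) Lc (KInvStep (d := d) Lc 0))) Lc M κ u) :=
    fun κ u => ⟨_, _, _, _, hδ, hVM κ u⟩
  have hρα : ∀ y : Site (d + 1), |(if y α % (Lc : ℤ) = (Lc : ℤ) - 1 then (1 : ℝ) else 0)| ≤ 1 := fun y => by split_ifs <;> simp
  have hρβ : ∀ w : Site (d + 1), |(if w β % (Lc : ℤ) = (Lc : ℤ) - 1 then (1 : ℝ) else 0)| ≤ 1 := fun w => by split_ifs <;> simp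
  have hEcov : ∀ (κ : Fin (d + 1)) (u t : Site (d + 1)), vertexOfK (unitK sf sm (coDressKBmAt (toSite r) Lc (KInvStep (d := d) Lc 0))) Lc (unitS sf sm (fun κ v => cE • wilsonA d κ v)) κ (u + t) =
      shiftK (-((Lc : ℤ) • t)) (vertexOfK (unitK sf sm (coDressKBmAt (toSite r) Lc (KInvStep (d := d) Lc 0))) Lc (unitS sf sm (fun κ v => cE • wilsonA d κ v)) κ u) :=
    fun κ u t => vertexOfK_translate (N := Lc) hXs (unitS_wilsonA_translate (d := d) sf sm cE) κ u t
  have hWcov : ∀ (κ : Fin (d + 1)) (u t : Site (d + 1)), vertexOfK (unitK sf sm (coDressKBmAt (toSite r) Lc (KInvStep (d := d) Lc 0))) Lc (unitS sf sm (fun κ v => cVH • vhSAt (toSite r) d Lc rfl κ v)) κ (u + t) =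
      shiftK (-((Lc : ℤ) • t)) (vertexOfK (unitK sf sm (coDressKBmAt (toSite r) Lc (KInvStep (d := d) Lc 0))) Lc (unitS sf sm (fun κ v => cVH • vhSAt (toSite r) d Lc rfl κ v)) κ u) :=
    fun κ u t => VHWordsZeroBorder.borderSlot_translate (r := r) hLc sf sm 0 (vhS_translate (r := r) hLc cVH) κ u t
  -- split both slots and the lattice sum
  simp only [dM_dressed_level0_split hLc hr sf sm cE cVH cΛ M]
  rw [Finset.sum_congr rfl fun c _ => tsum_direct_word_split (hLE μ (toSite c)) (hLW μ (toSite c)) (hLM μ (toSite c)) hX hVE hδ hVW hδ hVM hδ hρα hρβ ν (Sum.inl α) (Sum.inl β)]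
  simp only [Finset.sum_add_distrib]
  -- the eight sector zeros
  have z12 := (sum_box_wilson_vh_latticeVH_words_eq_zero (μ := μ) (ν := ν) (α := α) (β := β) hLc hr sf sm cE cVH 0).1
  have z13 : ∀ c : Site (d + 1), _ := fun c => tsum_right_vertexOfM_word_eq_zero hLc hr sf sm 0 hM hδM (hLE μ c) hρα hρβ ν (Sum.inl α) (Sum.inl β)
  have z21 := (sum_box_vh_wilson_latticeWilson_words_eq_zero (μ := μ) (ν := ν) (α := α) (β := β) hLc hr sf sm cE cVH Lc).1
  have z22 := (sum_box_vh_vh_words_eq_zero (μ := μ) (ν := ν) (α := α) (β := β) hLc hr sf sm cVH 0 Lc).1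
  have z23 : ∀ c : Site (d + 1), _ := fun c => tsum_right_vertexOfM_word_eq_zero hLc hr sf sm 0 hM hδM (hLW μ c) hρα hρβ ν (Sum.inl α) (Sum.inl β)
  have z31 : ∀ c : Site (d + 1), _ := fun c => tsum_vertexOfM_left_cov_word_eq_zero hLc hr sf sm 0 hM hδM hMcov hVE hδ hEcov
    (fun y s => face_weight_periodic Lc α y s) (fun w s => face_weight_periodic Lc β w s) hρα hρβ μ ν (Sum.inl α) (Sum.inl β) c
  have z32 : ∀ c : Site (d + 1), _ := fun c => tsum_vertexOfM_left_cov_word_eq_zero hLc hr sf sm 0 hM hδM hMcov hVW hδ hWcov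
    (fun y s => face_weight_periodic Lc α y s) (fun w s => face_weight_periodic Lc β w s) hρα hρβ μ ν (Sum.inl α) (Sum.inl β) c
  have z33 : ∀ c : Site (d + 1), _ := fun c => tsum_right_vertexOfM_word_eq_zero hLc hr sf sm 0 hM hδM (hLM μ c) hρα hρβ ν (Sum.inl α) (Sum.inl β)
  simp only [z12, z13, z21, z22, z23, z31, z32, z33, Finset.sum_const_zero, add_zero, zero_add]
  exact ee_word_value' hLc hr sf sm cE

/-- [folklore] **THE SWAP EXCHANGE WORD OF THE DRESSED LEVEL-0 SOURCE'S ff ZERO MODE IS THE SWAP `S^E ⊗ S^E` NUMBER**: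
`Σ_{c∈box Lc} Σ'_{u′} FF[(dM X̃♮_0 Lc S♮_0 M ν u′ ∘ X̃♮_0) ∘ dM X̃♮_0 Lc S♮_0 M μ c] = −K₁²·s_f²·E′·½·Lc^{d−1}·(Lc^{d+1} − Lc^{d−1})`, `E′ = [ν=μ][α=β] − [ν=β][α=μ]`
(`EEWordSwap.ee_word_swap_value` and the eight sector zeros). -/
theorem sum_box_tsum_swap_word_eq (hLc : 1 ≤ Lc) (hr : r ∈ box (d + 1) Lc) (sf sm cE cVH cΛ : ℝ) (hM : VertexFamily M Lc CM δM) (hδM : 0 < δM)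
    (hMcov : ∀ (ρ' : Fin (d + 1)) (w t : Site (d + 1)), M ρ' (w + t) = shiftK (-((Lc : ℤ) • t)) (M ρ' w)) :
    ∑ c ∈ box (d + 1) Lc, ∑' u' : Site (d + 1), ∑' yw : Site (d + 1) × Site (d + 1), (if yw.1 α % (Lc : ℤ) = (Lc : ℤ) - 1 then (1 : ℝ) else 0) * (if yw.2 β % (Lc : ℤ) = (Lc : ℤ) - 1 then (1 : ℝ) else 0) *
        comp (comp (dM (unitK sf sm (coDressKBmAt (toSite r) Lc (KInvStep (d := d) Lc 0))) Lc (unitS sf sm (SpureRecAt d Lc (toSite r) cE cVH cΛ 0)) M ν u')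
          (unitK sf sm (coDressKBmAt (toSite r) Lc (KInvStep (d := d) Lc 0))))
          (dM (unitK sf sm (coDressKBmAt (toSite r) Lc (KInvStep (d := d) Lc 0))) Lc (unitS sf sm (SpureRecAt d Lc (toSite r) cE cVH cΛ 0)) M μ (toSite c)) yw.1 yw.2 (Sum.inl α) (Sum.inl β) =
      -(((((Lc : ℝ) * (sm * sf)) * ((((Lc ^ (0 + 1) : ℕ) : ℝ)) ^ (d + 1 + 1))⁻¹) * ((sf * sm)⁻¹ * (sf⁻¹ * sf⁻¹) * cE))) ^ 2 * (sf * sf) *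
        (((if ν = μ ∧ α = β then (1 : ℝ) else 0) - (if ν = β ∧ α = μ then (1 : ℝ) else 0)) * ((1 / 2 : ℝ) * (Lc : ℝ) ^ (d - 1) * ((Lc : ℝ) ^ (d + 1) - (Lc : ℝ) ^ (d - 1)))) := by
  classical
  obtain ⟨δ, CX, Cv, Cw, Cm, hδ, hXd, hVE, hVW, hVM⟩ := exists_sector_data hLc hr sf sm cE cVH hM hδM
  have hX : Spr (unitK sf sm (coDressKBmAt (toSite r) Lc (KInvStep (d := d) Lc 0))) := ⟨_, _, hδ, hXd⟩
  have hXs : ∀ t : Site (d + 1), shiftK (-((Lc : ℤ) • t)) (unitK sf sm (coDressKBmAt (toSite r) Lc (KInvStep (d := d) Lc 0))) =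
      unitK sf sm (coDressKBmAt (toSite r) Lc (KInvStep (d := d) Lc 0)) := fun t => shiftK_dressedStep (r := r) hLc sf sm 0 t
  have hLE : ∀ (κ : Fin (d + 1)) (u : Site (d + 1)), Loc (vertexOfK (unitK sf sm (coDressKBmAt (toSite r) Lc (KInvStep (d := d) Lc 0))) Lc (unitS sf sm (fun κ v => cE • wilsonA d κ v)) κ u) :=
    fun κ u => ⟨_, _, _, _, hδ, hVE κ u⟩
  have hLW : ∀ (κ : Fin (d + 1)) (u : Site (d + 1)), Loc (vertexOfK (unitK sf sm (coDressKBmAt (toSite r) Lc (KInvStep (d := d) Lc 0))) Lc (unitS sf sm (fun κ v => cVH • vhSAt (toSite r) d Lc rfl κ v)) κ u) :=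
    fun κ u => ⟨_, _, _, _, hδ, hVW κ u⟩
  have hLM : ∀ (κ : Fin (d + 1)) (u : Site (d + 1)), Loc (vertexOfM (unitK sf sm (coDressKBmAt (toSite r) Lc (KInvStep (d := d) Lc 0))) Lc M κ u) :=
    fun κ u => ⟨_, _, _, _, hδ, hVM κ u⟩
  have hρα : ∀ y : Site (d + 1), |(if y α % (Lc : ℤ) = (Lc : ℤ) - 1 then (1 : ℝ) else 0)| ≤ 1 := fun y => by split_ifs <;> simp
  have hρβ : ∀ w : Site (d + 1), |(if w β % (Lc : ℤ) = (Lc : ℤ) - 1 then (1 : ℝ) else 0)| ≤ 1 := fun w => by split_ifs <;> simp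
  have hEcov : ∀ (κ : Fin (d + 1)) (u t : Site (d + 1)), vertexOfK (unitK sf sm (coDressKBmAt (toSite r) Lc (KInvStep (d := d) Lc 0))) Lc (unitS sf sm (fun κ v => cE • wilsonA d κ v)) κ (u + t) =
      shiftK (-((Lc : ℤ) • t)) (vertexOfK (unitK sf sm (coDressKBmAt (toSite r) Lc (KInvStep (d := d) Lc 0))) Lc (unitS sf sm (fun κ v => cE • wilsonA d κ v)) κ u) :=
    fun κ u t => vertexOfK_translate (N := Lc) hXs (unitS_wilsonA_translate (d := d) sf sm cE) κ u t
  have hWcov : ∀ (κ : Fin (d + 1)) (u t : Site (d + 1)), vertexOfK (unitK sf sm (coDressKBmAt (toSite r) Lc (KInvStep (d := d) Lc 0))) Lc (unitS sf sm (fun κ v => cVH • vhSAt (toSite r) d Lc rfl κ v)) κ (u + t) =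
      shiftK (-((Lc : ℤ) • t)) (vertexOfK (unitK sf sm (coDressKBmAt (toSite r) Lc (KInvStep (d := d) Lc 0))) Lc (unitS sf sm (fun κ v => cVH • vhSAt (toSite r) d Lc rfl κ v)) κ u) :=
    fun κ u t => VHWordsZeroBorder.borderSlot_translate (r := r) hLc sf sm 0 (vhS_translate (r := r) hLc cVH) κ u t
  simp only [dM_dressed_level0_split hLc hr sf sm cE cVH cΛ M]
  rw [Finset.sum_congr rfl fun c _ => tsum_swap_word_split (hLE μ (toSite c)) (hLW μ (toSite c)) (hLM μ (toSite c)) hX hVE hδ hVW hδ hVM hδ hρα hρβ ν (Sum.inl α) (Sum.inl β)]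
  simp only [Finset.sum_add_distrib]
  -- the eight sector zeros (left slot on the lattice bond)
  have z12 := (sum_box_vh_wilson_latticeWilson_words_eq_zero (μ := μ) (ν := ν) (α := α) (β := β) hLc hr sf sm cE cVH Lc).2
  have z13 : ∀ c : Site (d + 1), _ := fun c => tsum_vertexOfM_right_cov_word_eq_zero hLc hr sf sm 0 hM hδM hMcov hVE hδ hEcov
    (fun y s => face_weight_periodic Lc α y s) (fun w s => face_weight_periodic Lc β w s) hρα hρβ μ ν (Sum.inl α) (Sum.inl β) c
  have z21 := (sum_box_wilson_vh_latticeVH_words_eq_zero (μ := μ) (ν := ν) (α := α) (β := β) hLc hr sf sm cE cVH 0).2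
  have z22 := (sum_box_vh_vh_words_eq_zero (μ := μ) (ν := ν) (α := α) (β := β) hLc hr sf sm cVH 0 Lc).2
  have z23 : ∀ c : Site (d + 1), _ := fun c => tsum_vertexOfM_right_cov_word_eq_zero hLc hr sf sm 0 hM hδM hMcov hVW hδ hWcov
    (fun y s => face_weight_periodic Lc α y s) (fun w s => face_weight_periodic Lc β w s) hρα hρβ μ ν (Sum.inl α) (Sum.inl β) c
  have z31 : ∀ c : Site (d + 1), _ := fun c => tsum_left_vertexOfM_word_eq_zero hLc hr sf sm 0 hM hδM (hLE μ c) hρα hρβ ν (Sum.inl α) (Sum.inl β)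
  have z32 : ∀ c : Site (d + 1), _ := fun c => tsum_left_vertexOfM_word_eq_zero hLc hr sf sm 0 hM hδM (hLW μ c) hρα hρβ ν (Sum.inl α) (Sum.inl β)
  have z33 : ∀ c : Site (d + 1), _ := fun c => tsum_left_vertexOfM_word_eq_zero hLc hr sf sm 0 hM hδM (hLM μ c) hρα hρβ ν (Sum.inl α) (Sum.inl β)
  simp only [z12, z13, z21, z22, z23, z31, z32, z33, Finset.sum_const_zero, add_zero, zero_add]
  exact ee_word_swap_value hLc hr sf sm cE

end Assembly

end Summit.QuantumFields.BalabanUV.Beta.GAN24.DressedSourceExchangeWords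

end
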